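import Summits.NavierStokesRegularity.NavierStokesRegularity.Theorems.AxisymmetricExtremalityAxisymmetricKatoGlobalStubSeregin2020TypeIILemma22MoserEnergyStep
import HarnessLib

/-!
# Nazarov–Uraltseva 2011, Cor. 3.2 (propagation of positivity, N4 of cell pub/ns-inputs), piece P1 = N-M1
# (the AXIS-FREE Moser step): the energy class tested with `H = ((l-·)₊)^q`, `Θ = φ³`, `η` — fixed time

This is the axis-free TWIN (`nu_moser_energy_step`) of `…Lemma22MoserEnergyStep.moser_energy_step` (seat wu-p33, A1): the energy class
hypothesis `hEC` is the A1 text with the axis integral `∫∫ η (2/ϱ) H(Φ) ∂_{e_r}(Θ²)` DELETED (the class of a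
non-negative supersolution of `∂ₜV − ΔV + b·∇V = 0` with a drift in the A1 drift class; N–U 2011 §3, no axis term),
everything else verbatim.  The proof is the A1 proof with the «axis term dropped by its sign» step removed (there is
no such term): testing the class with `H = ((l-τ)₊)^q` (`q > 2`), `Θ = φ³` (`φ = radialCutoff ρ₂ ρ₁`) and a time weight
`η ∈ C¹`, `0 ≤ η ≤ 1`, `|η'| ≤ B_η`, `η(t₁) M(t₁) = 0`, one gets for every `t₂ ∈ ]t₁, t₀[`

  `ofReal(η(t₂) ∫ (l-Φ(t₂))₊^q φ⁶) + ∫∫_{[t₁,t₂]×ℝ³} ½ η H''(Φ)|∇Φ|² φ⁶ ≤ E`,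
  `E = (36 L_φ² + B_η) ∫∫_{Q₁} (l-Φ)₊^q + ∫∫_{Q₁} 6 η (l-Φ)₊^q φ⁵ |U| ‖Dφ‖`,  `Q₁ = ]t₁,t₀[ × B̄(ρ₁)`.

Width seat ns-in-wu-341 g2 (director-ns inputs-23, plan g6 N4 cut P1); generic tools of the A1 files are used BY NAME
(`moserTheta_props`, `powerTest_energyClass_props`, `radialCutoff_*`, `restrict_Icc_prod_eq_restrict_Ioo_prod`).

## References

* A. I. Nazarov, N. N. Uraltseva, Algebra i Analiz 23:1 (2011) = St. Petersburg Math. J. 23 (2012) 93–115 =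
  arXiv:1011.1888, §3, Lemma 3.1, (3.2)–(3.3), Remarks 5, 9. [NazarovUraltseva2011HarnackDivFree]
* Z. Lei, X. Ren, G. Tian, arXiv:2501.08976, Lemma 2.5. [LeiRenTian2025]

WHAT THIS IS NOT: not a statement about Navier–Stokes regularity; one brick of the discharge of the NAMED fact
`NazarovUraltseva2011_positivity_propagation` (INPUT N4); nothing is closed by this file.
-/

-- the problem directory repeats the summit name (D-0017); core's `dupNamespace` linter fires
set_option linter.dupNamespace false

noncomputable section

open MeasureTheory Set Function Filter Topology Metric
open scoped NNReal ENNReal RealInnerProductSpace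

namespace Summit.NavierStokesRegularity.NavierStokesRegularity.Theorems.AveragedConeLiouville.NU

open Literature.Analysis.FluidPDE Literature.Analysis.FluidPDE.LeiZhang2011
open Summit.NavierStokesRegularity.NavierStokesRegularity.Theorems.AxisymmetricKatoGlobal.EulerScaling

/-! ### The energy bounds -/

/-- **N–U (3.2)→(3.3) in the AXIS-FREE energy class, at a fixed time `t₂`** (twin of the A1
`moser_energy_step`; module docstring): the class tested with `H = ((l-·)₊)^q`, `Θ = φ³`, `η` gives
`ofReal(η(t₂) ∫ (l-Φ(t₂))₊^q (φ³)²) + ∫∫_{[t₁,t₂]×ℝ³} ½ η H''(Φ)‖∇Φ‖² (φ³)² ≤ E`,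
`E = (36 L_φ² + B_η) ∫∫_{Q₁} (l-Φ)₊^q + ∫∫_{Q₁} 6 η (l-Φ)₊^q φ⁵ |U| ‖Dφ‖`, `Q₁ = ]t₁,t₀[ × B̄(0,ρ₁)`
(the `|∇Θ|²` and `|η'|` terms bounded pointwise, the drift term kept as a majorant).
[cite: NazarovUraltseva2011HarnackDivFree, §3 proof of Lemma 3.1, (3.2)–(3.3), Remark 5] -/
theorem nu_moser_energy_step
    (Φ : ℝ → EuclideanSpace ℝ (Fin 3) → ℝ)
    (U : ℝ → EuclideanSpace ℝ (Fin 3) → EuclideanSpace ℝ (Fin 3)) (k R : ℝ)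
    (hΦm : Measurable (uncurry Φ))
    (hEC : ∀ (H : ℝ → ℝ), ContDiff ℝ 2 H → (∀ v, deriv H v ≤ 0) → (∀ v, 0 ≤ H v) →
      (∀ v, 0 ≤ deriv (deriv H) v) → (∀ v, deriv H v ^ 2 ≤ 2 * H v * deriv (deriv H) v) →
      (∀ v, k ≤ v → H v = 0) →
      ∀ (Θ : EuclideanSpace ℝ (Fin 3) → ℝ), ContDiff ℝ 1 Θ → HasCompactSupport Θ →
        tsupport Θ ⊆ ball (0 : EuclideanSpace ℝ (Fin 3)) (2 * R) →
      ∀ (η : ℝ → ℝ), ContDiff ℝ 1 η → (∀ s, 0 ≤ η s) →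
      ∀ (t₁ t₂ : ℝ), -R ^ 2 < t₁ → t₁ ≤ t₂ → t₂ < 0 →
        ENNReal.ofReal (η t₂ * ∫ x, H (Φ t₂ x) * Θ x ^ 2) +
          ∫⁻ z in Icc t₁ t₂ ×ˢ (univ : Set (EuclideanSpace ℝ (Fin 3))), ENNReal.ofReal
            (1 / 2 * η z.1 * (deriv (deriv H) (Φ z.1 z.2) * ‖gradient (Φ z.1) z.2‖ ^ 2 *
              Θ z.2 ^ 2))
        ≤ ENNReal.ofReal (η t₁ * (∫ x, H (Φ t₁ x) * Θ x ^ 2) +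
            (4 * ∫ z in Icc t₁ t₂ ×ˢ (univ : Set (EuclideanSpace ℝ (Fin 3))),
              η z.1 * (H (Φ z.1 z.2) * ‖gradient Θ z.2‖ ^ 2)) +
            (∫ z in Icc t₁ t₂ ×ˢ (univ : Set (EuclideanSpace ℝ (Fin 3))),
              η z.1 * (H (Φ z.1 z.2) * inner ℝ (U z.1 z.2) (gradient (fun y => Θ y ^ 2) z.2))) +
            (∫ z in Icc t₁ t₂ ×ˢ (univ : Set (EuclideanSpace ℝ (Fin 3))),
              |deriv η z.1| * (H (Φ z.1 z.2) * Θ z.2 ^ 2))))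
    {ρ₂ ρ₁ t₁ t₀ l q Lφ Bη : ℝ} (hρ₂ : 0 < ρ₂) (hρ₁ : ρ₂ < ρ₁) (hρ₁R : ρ₁ < 2 * R)
    (ht₁ : -R ^ 2 < t₁) (ht₀ : t₀ ≤ 0) (hl : 0 < l) (hlk : l ≤ k) (hq : 2 < q)
    {φ : EuclideanSpace ℝ (Fin 3) → ℝ} (hφdef : φ = radialCutoff ρ₂ ρ₁)
    (hLφ : ∀ x, ‖fderiv ℝ φ x‖ ≤ Lφ)
    {η : ℝ → ℝ} (hη : ContDiff ℝ 1 η) (hη01 : ∀ s, 0 ≤ η s ∧ η s ≤ 1) (hBη0 : 0 ≤ Bη)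
    (hBη : ∀ s, |deriv η s| ≤ Bη)
    (hinit : η t₁ * (∫ x, max (l - Φ t₁ x) 0 ^ q * (φ x ^ 3) ^ 2) = 0) :
    ∀ t₂, t₁ < t₂ → t₂ < t₀ →
      ENNReal.ofReal (η t₂ * ∫ x, max (l - Φ t₂ x) 0 ^ q * (φ x ^ 3) ^ 2) +
        ∫⁻ z in Icc t₁ t₂ ×ˢ (univ : Set (EuclideanSpace ℝ (Fin 3))), ENNReal.ofReal
          (1 / 2 * η z.1 * (deriv (deriv fun τ : ℝ => max (l - τ) 0 ^ q) (Φ z.1 z.2) *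
            ‖gradient (Φ z.1) z.2‖ ^ 2 * (φ z.2 ^ 3) ^ 2)) ≤
      ENNReal.ofReal (36 * Lφ ^ 2 + Bη) *
          (∫⁻ z in Ioo t₁ t₀ ×ˢ closedBall (0 : EuclideanSpace ℝ (Fin 3)) ρ₁,
            ENNReal.ofReal (max (l - Φ z.1 z.2) 0 ^ q)) +
        ∫⁻ z in Ioo t₁ t₀ ×ˢ closedBall (0 : EuclideanSpace ℝ (Fin 3)) ρ₁,
          ENNReal.ofReal (6 * (η z.1 * max (l - Φ z.1 z.2) 0 ^ q) * φ z.2 ^ 5 *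
            ‖U z.1 z.2‖ * ‖fderiv ℝ φ z.2‖) := by
  -- `ofReal (∫ f) ≤ ∫⁻ ‖f‖ₑ` for a real function (no integrability needed)
  have ofReal_integral_le_lintegral_enorm : ∀ (μ : Measure (ℝ × EuclideanSpace ℝ (Fin 3)))
      (f : ℝ × EuclideanSpace ℝ (Fin 3) → ℝ), ENNReal.ofReal (∫ x, f x ∂μ) ≤ ∫⁻ x, ‖f x‖ₑ ∂μ := by
    intro μ f
    by_cases htop : ∫⁻ x, ‖f x‖ₑ ∂μ = ∞
    · rw [htop]; exact le_top
    have h1 := norm_integral_le_lintegral_norm (μ := μ) f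
    have h2 : ∫⁻ x, ENNReal.ofReal ‖f x‖ ∂μ = ∫⁻ x, ‖f x‖ₑ ∂μ :=
      lintegral_congr fun x => ofReal_norm _
    rw [h2] at h1
    calc ENNReal.ofReal (∫ x, f x ∂μ) ≤ ENNReal.ofReal ‖∫ x, f x ∂μ‖ :=
          ENNReal.ofReal_le_ofReal (Real.le_norm_self _)
      _ ≤ ENNReal.ofReal ((∫⁻ x, ‖f x‖ₑ ∂μ).toReal) := ENNReal.ofReal_le_ofReal h1
      _ = ∫⁻ x, ‖f x‖ₑ ∂μ := ENNReal.ofReal_toReal htop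
  ----------------------------------------------------------------
  -- notation and basic facts
  ----------------------------------------------------------------
  set K : Set (EuclideanSpace ℝ (Fin 3)) := closedBall (0 : EuclideanSpace ℝ (Fin 3)) ρ₁ with hK
  have hKm : MeasurableSet K := measurableSet_closedBall
  set H : ℝ → ℝ := fun τ => max (l - τ) 0 ^ q with hH
  obtain ⟨hH2, hH', hH0, hH'', hHsq, hHl, hHle, -⟩ := powerTest_energyClass_props hq hl.le
  have hHk : ∀ v, k ≤ v → H v = 0 := fun v hv => hHl v (hlk.trans hv)
  set Θ : EuclideanSpace ℝ (Fin 3) → ℝ := fun y => φ y ^ 3 with hΘ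
  obtain ⟨hΘ1, hΘc, hΘK, hφ01, hφone, hgradΘ, hdrift, -⟩ :=
    moserTheta_props hρ₂.le hρ₁ hφdef
  have hΘsupp : tsupport Θ ⊆ ball (0 : EuclideanSpace ℝ (Fin 3)) (2 * R) :=
    hΘK.trans (closedBall_subset_ball hρ₁R)
  have hφK : ∀ x, x ∉ K → φ x = 0 := fun x hx => by
    rw [hφdef]
    exact radialCutoff_eq_zero hρ₂.le hρ₁ (le_of_lt (by simpa [hK, mem_closedBall_zero_iff] using hx))
  have hDφK : ∀ x, x ∉ K → fderiv ℝ φ x = 0 := fun x hx => by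
    have hx' : x ∉ tsupport φ := fun h => hx (by
      rw [hφdef] at h; exact tsupport_radialCutoff_subset hρ₂.le hρ₁ h)
    exact fderiv_of_notMem_tsupport ℝ hx'
  have hη1 : ∀ s, η s ≤ 1 := fun s => (hη01 s).2
  have hη0 : ∀ s, 0 ≤ η s := fun s => (hη01 s).1
  -- the level function and its power
  set V : ℝ × EuclideanSpace ℝ (Fin 3) → ℝ := fun z => max (l - Φ z.1 z.2) 0 with hV
  have hV0 : ∀ z, 0 ≤ V z := fun z => le_max_right _ _
  have hVm : Measurable V := (measurable_const.sub hΦm).max measurable_const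
  have hHΦ : ∀ z : ℝ × EuclideanSpace ℝ (Fin 3), H (Φ z.1 z.2) = V z ^ q := fun z => rfl
  have hVq0 : ∀ z, 0 ≤ V z ^ q := fun z => Real.rpow_nonneg (hV0 z) _
  have hVqm : Measurable fun z => V z ^ q := hVm.pow_const _
  -- names for the two reference integrals
  set Q₁ : Set (ℝ × EuclideanSpace ℝ (Fin 3)) := Ioo t₁ t₀ ×ˢ K with hQ₁
  set I₁ : ℝ≥0∞ := ∫⁻ z in Q₁, ENNReal.ofReal (V z ^ q) with hI₁
  set DR : ℝ≥0∞ := ∫⁻ z in Q₁, ENNReal.ofReal (6 * (η z.1 * V z ^ q) * φ z.2 ^ 5 *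
    ‖U z.1 z.2‖ * ‖fderiv ℝ φ z.2‖) with hDR
  set E : ℝ≥0∞ := ENNReal.ofReal (36 * Lφ ^ 2 + Bη) * I₁ + DR with hE
  ----------------------------------------------------------------
  -- the three right-hand integrands and their majorants
  ----------------------------------------------------------------
  set T₁ : ℝ × EuclideanSpace ℝ (Fin 3) → ℝ := fun z =>
    η z.1 * (H (Φ z.1 z.2) * ‖gradient Θ z.2‖ ^ 2) with hT₁
  set T₂ : ℝ × EuclideanSpace ℝ (Fin 3) → ℝ := fun z =>
    η z.1 * (H (Φ z.1 z.2) * inner ℝ (U z.1 z.2) (gradient (fun y => Θ y ^ 2) z.2)) with hT₂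
  set T₄ : ℝ × EuclideanSpace ℝ (Fin 3) → ℝ := fun z =>
    |deriv η z.1| * (H (Φ z.1 z.2) * Θ z.2 ^ 2) with hT₄
  set KK : Set (ℝ × EuclideanSpace ℝ (Fin 3)) := (univ : Set ℝ) ×ˢ K with hKK
  have hKKm : MeasurableSet KK := MeasurableSet.univ.prod hKm
  have hmemKK : ∀ z : ℝ × EuclideanSpace ℝ (Fin 3), z ∈ KK ↔ z.2 ∈ K := fun z => by simp [hKK]
  -- majorant densities
  set F₁ : ℝ × EuclideanSpace ℝ (Fin 3) → ℝ≥0∞ := fun z =>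
    ENNReal.ofReal (9 * Lφ ^ 2) * ENNReal.ofReal (V z ^ q) with hF₁
  set F₂ : ℝ × EuclideanSpace ℝ (Fin 3) → ℝ≥0∞ := fun z =>
    ENNReal.ofReal (6 * (η z.1 * V z ^ q) * φ z.2 ^ 5 * ‖U z.1 z.2‖ * ‖fderiv ℝ φ z.2‖) with hF₂
  set F₄ : ℝ × EuclideanSpace ℝ (Fin 3) → ℝ≥0∞ := fun z =>
    ENNReal.ofReal Bη * ENNReal.ofReal (V z ^ q) with hF₄
  have hB₁ : ∀ z, ‖T₁ z‖ₑ ≤ KK.indicator F₁ z := by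
    intro z
    by_cases hz : z.2 ∈ K
    · rw [indicator_of_mem ((hmemKK z).2 hz), hF₁]
      dsimp only
      rw [← ENNReal.ofReal_mul (by positivity), Real.enorm_eq_ofReal_abs]
      refine ENNReal.ofReal_le_ofReal ?_
      show |η z.1 * (H (Φ z.1 z.2) * ‖gradient Θ z.2‖ ^ 2)| ≤
        9 * Lφ ^ 2 * max (l - Φ z.1 z.2) 0 ^ q
      rw [abs_of_nonneg (mul_nonneg (hη0 _) (mul_nonneg (hH0 _) (sq_nonneg _)))]
      show η z.1 * (max (l - Φ z.1 z.2) 0 ^ q * ‖gradient Θ z.2‖ ^ 2) ≤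
        9 * Lφ ^ 2 * max (l - Φ z.1 z.2) 0 ^ q
      have hg : ‖gradient Θ z.2‖ ^ 2 ≤ (3 * Lφ) ^ 2 :=
        pow_le_pow_left₀ (norm_nonneg _) ((hgradΘ z.2).trans (by nlinarith [hLφ z.2])) 2
      calc η z.1 * (max (l - Φ z.1 z.2) 0 ^ q * ‖gradient Θ z.2‖ ^ 2)
          ≤ 1 * (max (l - Φ z.1 z.2) 0 ^ q * (3 * Lφ) ^ 2) := by
            gcongr
            exact hη1 _
        _ = 9 * Lφ ^ 2 * max (l - Φ z.1 z.2) 0 ^ q := by ring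
    · rw [indicator_of_notMem (fun h => hz ((hmemKK z).1 h))]
      have hg0 : gradient Θ z.2 = 0 := by
        have : fderiv ℝ Θ z.2 = 0 := fderiv_of_notMem_tsupport ℝ (fun h => hz (hΘK h))
        simp [gradient, this]
      have : T₁ z = 0 := by
        show η z.1 * (H (Φ z.1 z.2) * ‖gradient Θ z.2‖ ^ 2) = 0
        rw [hg0]; simp
      rw [this, enorm_zero]
  have hB₂ : ∀ z, ‖T₂ z‖ₑ ≤ KK.indicator F₂ z := by
    intro z
    by_cases hz : z.2 ∈ K
    · rw [indicator_of_mem ((hmemKK z).2 hz), hF₂]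
      dsimp only
      rw [Real.enorm_eq_ofReal_abs]
      refine ENNReal.ofReal_le_ofReal ?_
      show |η z.1 * (H (Φ z.1 z.2) * inner ℝ (U z.1 z.2) (gradient (fun y => Θ y ^ 2) z.2))| ≤
        6 * (η z.1 * max (l - Φ z.1 z.2) 0 ^ q) * φ z.2 ^ 5 * ‖U z.1 z.2‖ * ‖fderiv ℝ φ z.2‖
      rw [abs_mul, abs_of_nonneg (hη0 _), abs_mul, abs_of_nonneg (hH0 _)]
      show η z.1 * (max (l - Φ z.1 z.2) 0 ^ q *
          |inner ℝ (U z.1 z.2) (gradient (fun y => (φ y ^ 3) ^ 2) z.2)|) ≤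
        6 * (η z.1 * max (l - Φ z.1 z.2) 0 ^ q) * φ z.2 ^ 5 * ‖U z.1 z.2‖ * ‖fderiv ℝ φ z.2‖
      have h := hdrift z.2 (U z.1 z.2)
      calc η z.1 * (max (l - Φ z.1 z.2) 0 ^ q *
            |inner ℝ (U z.1 z.2) (gradient (fun y => (φ y ^ 3) ^ 2) z.2)|)
          ≤ η z.1 * (max (l - Φ z.1 z.2) 0 ^ q *
              (6 * φ z.2 ^ 5 * ‖U z.1 z.2‖ * ‖fderiv ℝ φ z.2‖)) := by
            gcongr
            exact hη0 _
        _ = 6 * (η z.1 * max (l - Φ z.1 z.2) 0 ^ q) * φ z.2 ^ 5 * ‖U z.1 z.2‖ *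
              ‖fderiv ℝ φ z.2‖ := by ring
    · rw [indicator_of_notMem (fun h => hz ((hmemKK z).1 h))]
      have hφ0 : φ z.2 = 0 := hφK _ hz
      have hdiff : Differentiable ℝ φ := by
        rw [hφdef]; exact (radialCutoff_contDiff ρ₂ ρ₁ (n := 1)).differentiable one_ne_zero
      have hg0 : gradient (fun y => Θ y ^ 2) z.2 = 0 := by
        have hf0 : fderiv ℝ (fun y => Θ y ^ 2) z.2 = 0 := by
          rw [show (fun y => Θ y ^ 2) = fun y => (φ y ^ 3) ^ 2 from rfl,
            fderiv_pow_three_sq hdiff, hφ0]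
          simp
        simp [gradient, hf0]
      have : T₂ z = 0 := by
        show η z.1 * (H (Φ z.1 z.2) * inner ℝ (U z.1 z.2) (gradient (fun y => Θ y ^ 2) z.2)) = 0
        rw [hg0]; simp
      rw [this, enorm_zero]
  have hB₄ : ∀ z, ‖T₄ z‖ₑ ≤ KK.indicator F₄ z := by
    intro z
    by_cases hz : z.2 ∈ K
    · rw [indicator_of_mem ((hmemKK z).2 hz), hF₄]
      dsimp only
      rw [← ENNReal.ofReal_mul hBη0, Real.enorm_eq_ofReal_abs]
      refine ENNReal.ofReal_le_ofReal ?_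
      show |(|deriv η z.1|) * (H (Φ z.1 z.2) * Θ z.2 ^ 2)| ≤ Bη * max (l - Φ z.1 z.2) 0 ^ q
      rw [abs_mul, abs_abs, abs_of_nonneg (mul_nonneg (hH0 _) (sq_nonneg _))]
      show |deriv η z.1| * (max (l - Φ z.1 z.2) 0 ^ q * (φ z.2 ^ 3) ^ 2) ≤
        Bη * max (l - Φ z.1 z.2) 0 ^ q
      have hΘsq : (φ z.2 ^ 3) ^ 2 ≤ 1 :=
        pow_le_one₀ (pow_nonneg (hφ01 _).1 3) (pow_le_one₀ (hφ01 _).1 (hφ01 _).2)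
      calc |deriv η z.1| * (max (l - Φ z.1 z.2) 0 ^ q * (φ z.2 ^ 3) ^ 2)
          ≤ Bη * (max (l - Φ z.1 z.2) 0 ^ q * 1) := by
            gcongr
            exact hBη _
        _ = Bη * max (l - Φ z.1 z.2) 0 ^ q := by ring
    · rw [indicator_of_notMem (fun h => hz ((hmemKK z).1 h))]
      have : T₄ z = 0 := by
        show |deriv η z.1| * (H (Φ z.1 z.2) * Θ z.2 ^ 2) = 0
        rw [show Θ z.2 = φ z.2 ^ 3 from rfl, hφK _ hz]; simp
      rw [this, enorm_zero]
  ----------------------------------------------------------------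
  -- integrating the majorants over `[t₁, t₂] × ℝ³ ⊆ [t₁, t₀] × ℝ³`
  ----------------------------------------------------------------
  have hrestr : ∀ t₂, (volume.restrict (Icc t₁ t₂ ×ˢ (univ : Set (EuclideanSpace ℝ (Fin 3))))).restrict KK
      = volume.restrict (Icc t₁ t₂ ×ˢ K) := fun t₂ => by
    rw [Measure.restrict_restrict hKKm, hKK, prod_inter_prod, univ_inter, inter_univ]
  have hint_le : ∀ (F : ℝ × EuclideanSpace ℝ (Fin 3) → ℝ≥0∞) (t₂ : ℝ), t₂ < t₀ →
      ∫⁻ z in Icc t₁ t₂ ×ˢ (univ : Set (EuclideanSpace ℝ (Fin 3))), KK.indicator F z ≤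
        ∫⁻ z in Q₁, F z := by
    intro F t₂ ht₂
    rw [lintegral_indicator hKKm, hrestr t₂]
    calc ∫⁻ z in Icc t₁ t₂ ×ˢ K, F z ≤ ∫⁻ z in Icc t₁ t₀ ×ˢ K, F z :=
          lintegral_mono_set (prod_mono (Icc_subset_Icc le_rfl ht₂.le) le_rfl)
      _ = ∫⁻ z in Q₁, F z := by rw [hQ₁, restrict_Icc_prod_eq_restrict_Ioo_prod]
  have hI_T₁ : ∀ t₂, t₂ < t₀ →
      ∫⁻ z in Icc t₁ t₂ ×ˢ (univ : Set (EuclideanSpace ℝ (Fin 3))), ‖T₁ z‖ₑ ≤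
        ENNReal.ofReal (9 * Lφ ^ 2) * I₁ := by
    intro t₂ ht₂
    calc ∫⁻ z in Icc t₁ t₂ ×ˢ (univ : Set (EuclideanSpace ℝ (Fin 3))), ‖T₁ z‖ₑ
        ≤ ∫⁻ z in Icc t₁ t₂ ×ˢ (univ : Set (EuclideanSpace ℝ (Fin 3))), KK.indicator F₁ z :=
          lintegral_mono fun z => hB₁ z
      _ ≤ ∫⁻ z in Q₁, F₁ z := hint_le F₁ t₂ ht₂
      _ = ENNReal.ofReal (9 * Lφ ^ 2) * I₁ := by
          rw [hI₁, ← lintegral_const_mul' _ _ ENNReal.ofReal_ne_top]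
  have hI_T₂ : ∀ t₂, t₂ < t₀ →
      ∫⁻ z in Icc t₁ t₂ ×ˢ (univ : Set (EuclideanSpace ℝ (Fin 3))), ‖T₂ z‖ₑ ≤ DR := by
    intro t₂ ht₂
    calc ∫⁻ z in Icc t₁ t₂ ×ˢ (univ : Set (EuclideanSpace ℝ (Fin 3))), ‖T₂ z‖ₑ
        ≤ ∫⁻ z in Icc t₁ t₂ ×ˢ (univ : Set (EuclideanSpace ℝ (Fin 3))), KK.indicator F₂ z :=
          lintegral_mono fun z => hB₂ z
      _ ≤ ∫⁻ z in Q₁, F₂ z := hint_le F₂ t₂ ht₂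
      _ = DR := by rw [hDR]
  have hI_T₄ : ∀ t₂, t₂ < t₀ →
      ∫⁻ z in Icc t₁ t₂ ×ˢ (univ : Set (EuclideanSpace ℝ (Fin 3))), ‖T₄ z‖ₑ ≤
        ENNReal.ofReal Bη * I₁ := by
    intro t₂ ht₂
    calc ∫⁻ z in Icc t₁ t₂ ×ˢ (univ : Set (EuclideanSpace ℝ (Fin 3))), ‖T₄ z‖ₑ
        ≤ ∫⁻ z in Icc t₁ t₂ ×ˢ (univ : Set (EuclideanSpace ℝ (Fin 3))), KK.indicator F₄ z :=
          lintegral_mono fun z => hB₄ z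
      _ ≤ ∫⁻ z in Q₁, F₄ z := hint_le F₄ t₂ ht₂
      _ = ENNReal.ofReal Bη * I₁ := by
          rw [hI₁, ← lintegral_const_mul' _ _ ENNReal.ofReal_ne_top]
  ----------------------------------------------------------------
  -- the energy inequality at each `t₂ ∈ ]t₁, t₀[`
  ----------------------------------------------------------------
  have hstep : ∀ t₂, t₁ < t₂ → t₂ < t₀ →
      ENNReal.ofReal (η t₂ * ∫ x, H (Φ t₂ x) * Θ x ^ 2) +
        ∫⁻ z in Icc t₁ t₂ ×ˢ (univ : Set (EuclideanSpace ℝ (Fin 3))), ENNReal.ofReal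
          (1 / 2 * η z.1 * (deriv (deriv H) (Φ z.1 z.2) * ‖gradient (Φ z.1) z.2‖ ^ 2 *
            Θ z.2 ^ 2)) ≤ E := by
    intro t₂ h12 h20
    have ht₂0 : t₂ < 0 := h20.trans_le ht₀
    have h := hEC H hH2 hH' hH0 hH'' hHsq hHk Θ hΘ1 hΘc hΘsupp η hη hη0 t₁ t₂ ht₁ h12.le ht₂0
    have hrhs : ENNReal.ofReal (η t₁ * (∫ x, H (Φ t₁ x) * Θ x ^ 2) +
          (4 * ∫ z in Icc t₁ t₂ ×ˢ (univ : Set (EuclideanSpace ℝ (Fin 3))), T₁ z) +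
          (∫ z in Icc t₁ t₂ ×ˢ (univ : Set (EuclideanSpace ℝ (Fin 3))), T₂ z) +
          (∫ z in Icc t₁ t₂ ×ˢ (univ : Set (EuclideanSpace ℝ (Fin 3))), T₄ z)) ≤ E := by
      have h0 : η t₁ * (∫ x, H (Φ t₁ x) * Θ x ^ 2) = 0 := hinit
      set A₁ := ∫ z in Icc t₁ t₂ ×ˢ (univ : Set (EuclideanSpace ℝ (Fin 3))), T₁ z with hA₁
      set A₂ := ∫ z in Icc t₁ t₂ ×ˢ (univ : Set (EuclideanSpace ℝ (Fin 3))), T₂ z with hA₂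
      set A₄ := ∫ z in Icc t₁ t₂ ×ˢ (univ : Set (EuclideanSpace ℝ (Fin 3))), T₄ z with hA₄
      have hle : η t₁ * (∫ x, H (Φ t₁ x) * Θ x ^ 2) + 4 * A₁ + A₂ + A₄ ≤ 4 * A₁ + A₂ + A₄ := by
        rw [h0]; linarith
      have e4 : ENNReal.ofReal (4 * A₁) ≤ 4 * ENNReal.ofReal A₁ := by
        by_cases hA : 0 ≤ A₁
        · rw [ENNReal.ofReal_mul (by norm_num), ENNReal.ofReal_ofNat]
        · rw [ENNReal.ofReal_of_nonpos (by linarith)]; exact bot_le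
      have hEeq : 4 * (ENNReal.ofReal (9 * Lφ ^ 2) * I₁) + DR + ENNReal.ofReal Bη * I₁ = E := by
        have h36 : ENNReal.ofReal (36 * Lφ ^ 2 + Bη) =
            4 * ENNReal.ofReal (9 * Lφ ^ 2) + ENNReal.ofReal Bη := by
          rw [ENNReal.ofReal_add (by positivity) hBη0,
            show (36 : ℝ) * Lφ ^ 2 = 4 * (9 * Lφ ^ 2) by ring,
            ENNReal.ofReal_mul (by norm_num : (0 : ℝ) ≤ 4), ENNReal.ofReal_ofNat]
        rw [hE, h36]; ring
      calc ENNReal.ofReal (η t₁ * (∫ x, H (Φ t₁ x) * Θ x ^ 2) + 4 * A₁ + A₂ + A₄)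
          ≤ ENNReal.ofReal (4 * A₁ + A₂ + A₄) := ENNReal.ofReal_le_ofReal hle
        _ ≤ ENNReal.ofReal (4 * A₁) + ENNReal.ofReal A₂ + ENNReal.ofReal A₄ :=
            (ENNReal.ofReal_add_le).trans (add_le_add ENNReal.ofReal_add_le le_rfl)
        _ ≤ 4 * (∫⁻ z in Icc t₁ t₂ ×ˢ (univ : Set (EuclideanSpace ℝ (Fin 3))), ‖T₁ z‖ₑ) +
              (∫⁻ z in Icc t₁ t₂ ×ˢ (univ : Set (EuclideanSpace ℝ (Fin 3))), ‖T₂ z‖ₑ) +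
              ∫⁻ z in Icc t₁ t₂ ×ˢ (univ : Set (EuclideanSpace ℝ (Fin 3))), ‖T₄ z‖ₑ := by
            gcongr ?_ + ?_ + ?_
            · exact e4.trans (by gcongr; exact ofReal_integral_le_lintegral_enorm _ _)
            · exact ofReal_integral_le_lintegral_enorm _ _
            · exact ofReal_integral_le_lintegral_enorm _ _
        _ ≤ 4 * (ENNReal.ofReal (9 * Lφ ^ 2) * I₁) + DR + ENNReal.ofReal Bη * I₁ := by
            gcongr ?_ + ?_ + ?_
            · gcongr; exact hI_T₁ t₂ h20
            · exact hI_T₂ t₂ h20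
            · exact hI_T₄ t₂ h20
        _ = E := hEeq
    have h' : ENNReal.ofReal (η t₂ * ∫ x, H (Φ t₂ x) * Θ x ^ 2) +
        ∫⁻ z in Icc t₁ t₂ ×ˢ (univ : Set (EuclideanSpace ℝ (Fin 3))), ENNReal.ofReal
          (1 / 2 * η z.1 * (deriv (deriv H) (Φ z.1 z.2) * ‖gradient (Φ z.1) z.2‖ ^ 2 *
            Θ z.2 ^ 2)) ≤
        ENNReal.ofReal (η t₁ * (∫ x, H (Φ t₁ x) * Θ x ^ 2) +
          (4 * ∫ z in Icc t₁ t₂ ×ˢ (univ : Set (EuclideanSpace ℝ (Fin 3))), T₁ z) +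
          (∫ z in Icc t₁ t₂ ×ˢ (univ : Set (EuclideanSpace ℝ (Fin 3))), T₂ z) +
          (∫ z in Icc t₁ t₂ ×ˢ (univ : Set (EuclideanSpace ℝ (Fin 3))), T₄ z)) := by
      simpa only [hT₁, hT₂, hT₄] using h
    exact h'.trans hrhs
  exact hstep

end Summit.NavierStokesRegularity.NavierStokesRegularity.Theorems.AveragedConeLiouville.NU

end
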